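/-
Copyright (c) 2026. All rights reserved.
Released under Apache 2.0 license as described in the file LICENSE.
Authors: abc-iut cell, wave-6 cone prover seat abc-iut-w6-d036 (proof-only companion of
`LogFrobeniusCompatibility.lean`, node [AbsTopIII] Prop 5.8 (vii)).
-/
import Mathlib.CategoryTheory.Equivalence
import Mathlib.CategoryTheory.InducedCategory
import Mathlib.CategoryTheory.Products.Basic
import Mathlib.CategoryTheory.Whiskering
import Literature.AnabelianGeometry.AbsoluteAnabelian.LogFrobeniusCompatibility
import HarnessLib

/-!
# [AbsTopIII] Proposition 5.8 (vii): the equivalence `Th⊢[Z] ⥲ An⊢[𝒩⊢⊞_w]`, the forgetful functors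
`ψ^{An⊢⊞}_{w,ν}` and the natural transformations `ι^{An⊢⊞}_{w,ε}` — PROVED (printed, definitional shape)

S. Mochizuki, *Topics in absolute anabelian geometry III: global reconstruction algorithms*,
J. Math. Sci. Univ. Tokyo 22 (2015) 939–1156 [MochizukiAbsTopIII2015]; locators `p.N l.M` = pages/lines of the
author's manuscript (164 pp.; the cell's render `lit/renders/AbsTopIII-kurims-url-5493eb38cbb7`), read on the page:
Prop 5.8 (vii) p. 141 l. 44 – p. 142 l. 9; printed proof p. 142 l. 10–11: "The various assertions of Proposition
5.8 are immediate from the definitions and the references quoted in these definitions."; Def 5.6 (iii) p. 136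
l. 4–12 (`𝒩⊢⊞_w := Orb(𝒞^{MLF⊢}_{TS⊞}) ×_{Orb(TG⊢),w} Th⊢[Z]`, "natural functors `𝒩⊢⊞_w → 𝒩⊢_w → Th⊢[Z]`").

Prop 5.8 (vii) (p. 141 l. 44 – p. 142 l. 9), verbatim: "Write `An⊢[𝒩⊢⊞_w]` for the category whose objects consist
of an object of `Th⊢[Z]`, together with the object of `Orb(𝒞^{MLF⊢}_{TS⊞}[Γ⃗×_non])` (respectively,
`Orb(𝒞^{hol⊢}_{TB⊞}[Γ⃗×_arc])`) given by applying the algorithm “`G ↦ Γ⃗×_non(G)`” of (ii) (respectively,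
“`G ↦ Γ⃗×_arc(G)`” of (v)) to the object of `Orb(TG⊢)` (respectively, `Orb(TM⊢)`) obtained by projecting [at `w`]
the given object of `Th⊢[Z]`, and whose morphisms are the morphisms induced by `Th⊢[Z]`. Thus we obtain a natural
equivalence of categories `Th⊢[Z] ⥲ An⊢[𝒩⊢⊞_w]` together with a “forgetful functor”
`ψ^{An⊢⊞}_{w,ν} : An⊢[𝒩⊢⊞_w] → 𝒩⊢⊞_w` [cf. Definition 5.6, (iii), (iv)] for each vertex `ν` of `Γ⃗×_w` …, and a
natural transformation `ι^{An⊢⊞}_{w,ε} : ψ^{An⊢⊞}_{w,ν₁} → ψ^{An⊢⊞}_{w,ν₂}` for each edge `ε` of `Γ⃗×_w` running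
from a vertex `ν₁` to a vertex `ν₂`. Finally, we shall omit the symbol “⊞” from the above notation to denote the
result of composing the functors and natural transformations discussed above with the natural functor
`𝒩⊢⊞_w → 𝒩⊢_w`; also, we shall replace the symbol “An⊢” by the symbol “⊢” … to denote the result of
restricting the functors and natural transformations discussed above to `Th⊢[Z]`."

## What is proved here and how (proof-only companion; no `def`, no named `Prop` fact)

The statement-typer (abc-iut-L4-t3, `LogFrobeniusCompatibility.lean`, FROZEN) types Prop 5.8 (vii) as INTERFACE
DATA of `LogFrobeniusSetting`: the category `AnMono` (`An⊢[𝒩⊢⊞]`), the equivalence `κAnMono : Emono ≌ AnMono`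
and the forgetful functors `ψAnMono`, consumed by the arrows `DEdge.κAnMono` / `DEdge.anMonoToE` / `DEdge.monoAn`
of the diagram `D•⊢`. The ONE printed claim of (vii) — "Thus we obtain a natural equivalence of categories" — is,
exactly as for the twin clause Cor 5.2 (v) (`Cor52v.equivalence_tautological`, `MonoAnalyticLogShellsSubProofs`),
definitional once the algorithm of (ii)/(v) exists: the objects of `An⊢[𝒩⊢⊞_w]` are the objects `W` of `Th⊢[Z]`
DECORATED by a datum determined by `W` (the algorithm output at the projection `G_w` of `W`), and its morphisms
are DEFINED to be those of `Th⊢[Z]`. In Mathlib's language `An⊢[𝒩⊢⊞_w]` is the category INDUCED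
(`CategoryTheory.InducedCategory`) along the first projection `Σ W, T W → Th⊢[Z]` for a decoration family `T` with
inhabited fibres (print: `T W = {the output of the algorithm at G_w}`, a singleton). We kernel-check, universe-
polymorphically (so that it applies at the levels `Type (u+1)` / `Category.{u}` of the frozen interface):

* `Prop58vii.forget_isEquivalence_of_nonempty` / `forget_isEquivalence`: the forgetful functor
  `An⊢[𝒩⊢⊞_w] ⥤ Th⊢[Z]` is an equivalence (fully faithful by construction, essentially surjective because every
  fibre is inhabited);
* `Prop58vii.exists_equivalence`: the printed direction `Th⊢[Z] ⥲ An⊢[𝒩⊢⊞_w]` ON THE NOSE — there is an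
  equivalence `e` with `e.inverse =` the forgetful functor, `e.functor ⋙ forget = 𝟭`, `e.functor.obj W = (W, t W)`;
* `Prop58vii.exists_iota` / `iota_naturality`: for a FUNCTORIAL algorithm `A : Th⊢[Z] ⥤ (Γ ⥤ N)` (print: "functorial
  algorithm" (ii)/(v), its value at `W` read as the `Γ⃗×_w`-diagram `Γ⃗×_w(G_w)` in `N = 𝒩⊢⊞_w`), the forgetful
  functors `ψ_ν := forget ⋙ A ⋙ ev_ν` and, for an edge `ε : ν₁ ⟶ ν₂`, the `ε`-arrows of the diagrams ASSEMBLE into a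
  natural transformation `ι_ε : ψ_{ν₁} ⟶ ψ_{ν₂}` (components `(A.obj W).map ε`) — the naturality is the
  functoriality of the algorithm, nothing else;
* `Prop58vii.exists_iota_whiskerRight` ("omit ⊞": compose with any `F : N ⥤ N'`, print `𝒩⊢⊞_w → 𝒩⊢_w`) and
  `Prop58vii.exists_iota_restrict` ("replace An⊢ by ⊢": restrict along `e.functor`, i.e. work on `Th⊢[Z]` itself);
* BY NAME at the frozen interface: `LogFrobeniusSetting.prop58vii_nonempty_equivalence` — for every
  `S : LogFrobeniusSetting` and every object-level algorithm `V` on `S.Emono = Th⊢[Z]` the print-defined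
  `An⊢[𝒩⊢⊞_w]` is equivalent to `S.Emono`; so the interface datum `κAnMono` carries no proof debt beyond the
  existence of the algorithm (Prop 5.8 (ii)/(v): `MonoAnalyticNonarchAlgorithm` / `MonoAnalyticArchAlgorithm`,
  inhabited at the models by abc-iut-L6-d2 / w4-d020), and `LogFrobeniusSetting.dEdge_κAnMono_isEquivalence` /
  `dEdge_anMonoToE_isEquivalence` — the two `D•⊢` arrows of rows 5–7 realised from that datum by the node's decl
  of record `DEdge.functor` are equivalences of categories.

HONEST FRAMING: refereed pre-IUT anabelian geometry; the content of (vii) is categorical bookkeeping and is proved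
here in exactly the (definitional) shape print gives it — the anabelian input is the EXISTENCE of the algorithms of
Prop 5.8 (ii)/(v), consumed by name and not restated; nothing here bears on [IUTchIII] Cor. 3.12; proof-only file
(theorems only), no definitions, no named facts, no side taken; typed ≠ proved — what is proved here is exactly
the list above.
-/

set_option autoImplicit false

noncomputable section

universe w w' v v' v'' v''' u u' u''

namespace Literature.AnabelianGeometry.AbsoluteAnabelian

open CategoryTheory

namespace Prop58vii

/-! ## The equivalence `Th⊢[Z] ⥲ An⊢[𝒩⊢⊞_w]` (abstract, definitional shape) -/

/-- **Prop 5.8 (vii), the equivalence clause, fibrewise form** (p. 141 l. 44 – p. 142 l. 3): let `E` be a category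
(print: `Th⊢[Z]`) and `T W` the type of admissible decorations of an object `W` (print: the singleton consisting of
the output of the algorithm of (ii)/(v) at the projection `G_w` of `W`); the category "whose objects consist of an
object of `E` together with a decoration, and whose morphisms are the morphisms induced by `E`" is the induced
category along `Σ W, T W → E`, and its forgetful functor to `E` is an equivalence of categories as soon as every
fibre `T W` is inhabited (fully faithful by definition of the induced morphisms; essentially surjective since `W`
is the image of `(W, t)` for any `t ∈ T W`). [cite: MochizukiAbsTopIII2015, Prop 5.8 (vii) p. 141] -/
theorem forget_isEquivalence_of_nonempty {E : Type u} [Category.{v} E] (T : E → Type w)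
    (hT : ∀ W, Nonempty (T W)) :
    (inducedFunctor (Sigma.fst (β := T))).IsEquivalence := by
  haveI : (inducedFunctor (Sigma.fst (β := T))).EssSurj :=
    ⟨fun W => ⟨⟨W, (hT W).some⟩, ⟨Iso.refl _⟩⟩⟩
  exact { }

/-- **Prop 5.8 (vii), the equivalence clause, printed form** (p. 141 l. 44 – p. 142 l. 3): for ANY object-level
assignment `V : E → D` (print: `W ↦ Γ⃗×_w(G_w)`, "the object … given by applying the algorithm … to the object …
obtained by projecting [at `w`] the given object of `Th⊢[Z]`"), the category of pairs `(W, d)` with `d = V W` and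
morphisms induced by `E` — `An⊢[𝒩⊢⊞_w]` as DEFINED in print — has its forgetful functor to `E` an equivalence.
Same shape as `Cor52v.equivalence_tautological` (Cor 5.2 (v)), here universe-polymorphic so that it applies to the
large categories (`Type (u+1)`, `Category.{u}`) of the frozen interface `LogFrobeniusSetting`.
[cite: MochizukiAbsTopIII2015, Prop 5.8 (vii) p. 141] -/
theorem forget_isEquivalence {E : Type u} [Category.{v} E] {D : Type w} (V : E → D) :
    (inducedFunctor (Sigma.fst (β := fun W : E => {d : D // d = V W}))).IsEquivalence :=
  forget_isEquivalence_of_nonempty (fun W : E => {d : D // d = V W}) fun W => ⟨⟨V W, rfl⟩⟩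

/-- **Prop 5.8 (vii): "Thus we obtain a natural equivalence of categories `Th⊢[Z] ⥲ An⊢[𝒩⊢⊞_w]`"**, in the
printed direction and ON THE NOSE: given a chosen decoration `t W ∈ T W` of every object (print: THE output of the
algorithm), there is an equivalence `e : E ≌ An` whose inverse IS the forgetful functor, whose functor is a strict
section of it (`e.functor ⋙ forget = 𝟭 E`), and which sends `W` to `(W, t W)` — i.e. `e.functor` is the printed
assignment "`W ↦ (W, Γ⃗×_w(G_w))`" with morphisms `f ↦ f`. [cite: MochizukiAbsTopIII2015, Prop 5.8 (vii) p. 141] -/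
theorem exists_equivalence {E : Type u} [Category.{v} E] (T : E → Type w) (t : ∀ W, T W) :
    ∃ e : E ≌ InducedCategory E (Sigma.fst (β := T)),
      e.inverse = inducedFunctor (Sigma.fst (β := T)) ∧
        e.functor ⋙ inducedFunctor (Sigma.fst (β := T)) = 𝟭 E ∧
          ∀ W, e.functor.obj W = ⟨W, t W⟩ := by
  refine ⟨CategoryTheory.Equivalence.mk
      { obj := fun W => ⟨W, t W⟩
        map := fun f => InducedCategory.homMk f }
      (inducedFunctor (Sigma.fst (β := T)))
      (NatIso.ofComponents (fun W => Iso.refl W) fun f => ?_)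
      (NatIso.ofComponents (fun X => InducedCategory.isoMk (Iso.refl X.1)) fun f => ?_), rfl, rfl, fun W => rfl⟩
  · exact (Category.comp_id f).trans (Category.id_comp f).symm
  · ext
    exact (Category.comp_id f.hom).trans (Category.id_comp f.hom).symm

/-- **Prop 5.8 (vii), equivalence clause, printed decoration** (p. 141): the `Nonempty` form of
`exists_equivalence` for the print-defined `An⊢[𝒩⊢⊞_w]` (decorations `{d // d = V W}`): "we obtain a natural
equivalence of categories `Th⊢[Z] ⥲ An⊢[𝒩⊢⊞_w]`". [cite: MochizukiAbsTopIII2015, Prop 5.8 (vii) p. 141] -/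
theorem nonempty_equivalence {E : Type u} [Category.{v} E] {D : Type w} (V : E → D) :
    Nonempty (E ≌ InducedCategory E (Sigma.fst (β := fun W : E => {d : D // d = V W}))) := by
  obtain ⟨e, -⟩ := exists_equivalence (fun W : E => {d : D // d = V W}) fun W => ⟨V W, rfl⟩
  exact ⟨e⟩

/-! ## The forgetful functors `ψ^{An⊢⊞}_{w,ν}` and the natural transformations `ι^{An⊢⊞}_{w,ε}` -/

/-- **Prop 5.8 (vii), the natural transformations `ι^{An⊢⊞}_{w,ε}`** (p. 142 l. 1–4): let the algorithm be
FUNCTORIAL — a functor `A : E ⥤ (Γ ⥤ N)` assigning to `W ∈ Ob(Th⊢[Z])` its `Γ⃗×_w`-diagram `Γ⃗×_w(G_w)` in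
`N = 𝒩⊢⊞_w` (print (ii)/(v): "a functorial algorithm"; Def 5.6 (iii): every vertex of the diagram is an object of
`𝒩⊢⊞_w` lying over `W`). On the decorated category `An` (ANY decoration family `T`) the "forgetful functor"
`ψ_ν := forget ⋙ A ⋙ ev_ν : An ⥤ N` reads off the vertex `ν`, and for an edge `ε : ν₁ ⟶ ν₂` of `Γ` the `ε`-arrows of
the diagrams form a natural transformation `ι_ε : ψ_{ν₁} ⟶ ψ_{ν₂}` with components `ι_ε(W, d) = (A W)(ε)`; it is
the whiskering of Mathlib's `(evaluation Γ N).map ε`. [cite: MochizukiAbsTopIII2015, Prop 5.8 (vii) p. 142] -/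
theorem exists_iota {E : Type u} [Category.{v} E] (T : E → Type w) {Γ : Type u'} [Category.{v'} Γ]
    {N : Type u''} [Category.{v''} N] (A : E ⥤ (Γ ⥤ N)) {ν₁ ν₂ : Γ} (ε : ν₁ ⟶ ν₂) :
    ∃ ι : inducedFunctor (Sigma.fst (β := T)) ⋙ A ⋙ (evaluation Γ N).obj ν₁ ⟶
        inducedFunctor (Sigma.fst (β := T)) ⋙ A ⋙ (evaluation Γ N).obj ν₂,
      ∀ X, ι.app X = (A.obj X.1).map ε :=
  ⟨Functor.whiskerLeft (inducedFunctor (Sigma.fst (β := T)) ⋙ A) ((evaluation Γ N).map ε), fun _ => rfl⟩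

/-- **Prop 5.8 (vii), naturality of `ι^{An⊢⊞}_{w,ε}` spelled out** (p. 142 l. 1–4): for a morphism `f : X ⟶ Y` of
`An⊢[𝒩⊢⊞_w]` (by definition a morphism `X.1 ⟶ Y.1` of `Th⊢[Z]`) and an edge `ε : ν₁ ⟶ ν₂`, the square
`ψ_{ν₁}(f) ≫ ι_ε(Y) = ι_ε(X) ≫ ψ_{ν₂}(f)` commutes — because `A f` is a morphism of `Γ`-diagrams. This is the whole
mathematical content of "natural transformation" in (vii). [cite: MochizukiAbsTopIII2015, Prop 5.8 (vii) p. 142] -/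
theorem iota_naturality {E : Type u} [Category.{v} E] (T : E → Type w) {Γ : Type u'} [Category.{v'} Γ]
    {N : Type u''} [Category.{v''} N] (A : E ⥤ (Γ ⥤ N)) {ν₁ ν₂ : Γ} (ε : ν₁ ⟶ ν₂)
    {X Y : InducedCategory E (Sigma.fst (β := T))} (f : X ⟶ Y) :
    (A.map f.hom).app ν₁ ≫ (A.obj Y.1).map ε = (A.obj X.1).map ε ≫ (A.map f.hom).app ν₂ :=
  ((A.map f.hom).naturality ε).symm

/-- **Prop 5.8 (vii), "omit the symbol ⊞"** (p. 142 l. 4–7): composing with any functor `F : N ⥤ N'` (print: the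
natural functor `𝒩⊢⊞_w → 𝒩⊢_w` of Def 5.6 (iii)) gives forgetful functors `ψ_ν ⋙ F` and natural transformations
`ι_ε ▫ F` with components `F((A W)(ε))`. [cite: MochizukiAbsTopIII2015, Prop 5.8 (vii) p. 142] -/
theorem exists_iota_whiskerRight {E : Type u} [Category.{v} E] (T : E → Type w) {Γ : Type u'}
    [Category.{v'} Γ] {N : Type u''} [Category.{v''} N] {N' : Type w'} [Category.{v'''} N']
    (A : E ⥤ (Γ ⥤ N)) (F : N ⥤ N') {ν₁ ν₂ : Γ} (ε : ν₁ ⟶ ν₂) :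
    ∃ ι : (inducedFunctor (Sigma.fst (β := T)) ⋙ A ⋙ (evaluation Γ N).obj ν₁) ⋙ F ⟶
        (inducedFunctor (Sigma.fst (β := T)) ⋙ A ⋙ (evaluation Γ N).obj ν₂) ⋙ F,
      ∀ X, ι.app X = F.map ((A.obj X.1).map ε) :=
  ⟨Functor.whiskerRight
      (Functor.whiskerLeft (inducedFunctor (Sigma.fst (β := T)) ⋙ A) ((evaluation Γ N).map ε)) F,
    fun _ => rfl⟩

/-- **Prop 5.8 (vii), "replace the symbol An⊢ by ⊢"** (p. 142 l. 7–9): restricting along the equivalence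
`Th⊢[Z] ⥲ An⊢[𝒩⊢⊞_w]` — i.e. working on `E = Th⊢[Z]` itself — the forgetful functors become `ψ⊢_ν = A ⋙ ev_ν` and
the `ε`-arrows again form a natural transformation `ι⊢_ε : ψ⊢_{ν₁} ⟶ ψ⊢_{ν₂}`, `ι⊢_ε(W) = (A W)(ε)`; and for the
on-the-nose equivalence `e` of `exists_equivalence` one has literally `e.functor ⋙ ψ_ν = ψ⊢_ν`.
[cite: MochizukiAbsTopIII2015, Prop 5.8 (vii) p. 142] -/
theorem exists_iota_restrict {E : Type u} [Category.{v} E] (T : E → Type w) (t : ∀ W, T W) {Γ : Type u'}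
    [Category.{v'} Γ] {N : Type u''} [Category.{v''} N] (A : E ⥤ (Γ ⥤ N)) {ν₁ ν₂ : Γ} (ε : ν₁ ⟶ ν₂) :
    (∃ ι : A ⋙ (evaluation Γ N).obj ν₁ ⟶ A ⋙ (evaluation Γ N).obj ν₂, ∀ W, ι.app W = (A.obj W).map ε) ∧
      ∃ e : E ≌ InducedCategory E (Sigma.fst (β := T)),
        ∀ ν : Γ, e.functor ⋙ (inducedFunctor (Sigma.fst (β := T)) ⋙ A ⋙ (evaluation Γ N).obj ν) =
          A ⋙ (evaluation Γ N).obj ν := by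
  refine ⟨⟨Functor.whiskerLeft A ((evaluation Γ N).map ε), fun _ => rfl⟩, ?_⟩
  obtain ⟨e, -, he, -⟩ := exists_equivalence T t
  refine ⟨e, fun ν => ?_⟩
  rw [← Functor.assoc, he, Functor.id_comp]

end Prop58vii

/-! ## At the frozen interface `LogFrobeniusSetting` (node decls, BY NAME) -/

namespace LogFrobeniusSetting

variable {Vmod : Type u} {isArc : Vmod → Bool} (S : LogFrobeniusSetting Vmod isArc)

/-- **Prop 5.8 (vii) at the interface** (p. 141 l. 44 – p. 142 l. 3): for the category `S.Emono = Th⊢[Z]` of a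
`LogFrobeniusSetting` and ANY object-level algorithm `V` on it (print: `W⊢ ↦ Γ⃗×_w(G_w)`, the algorithm of
Prop 5.8 (ii)/(v) applied at the projection `G_w`, Def 5.6 (ii)), the print-defined category `An⊢[𝒩⊢⊞_w]`
(objects `(W, V W)`, morphisms those of `Th⊢[Z]`) is equivalent to `Th⊢[Z]`: the interface datum
`S.κAnMono : S.Emono ≌ S.AnMono` is realisable by print's own definition and carries no proof debt beyond the
existence of the algorithm. [cite: MochizukiAbsTopIII2015, Prop 5.8 (vii) p. 141] -/
theorem prop58vii_nonempty_equivalence {D : Type w} (V : S.Emono → D) :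
    Nonempty (S.Emono ≌ InducedCategory S.Emono (Sigma.fst (β := fun W : S.Emono => {d : D // d = V W}))) :=
  Prop58vii.nonempty_equivalence V

/-- **The `D•⊢` arrow `ℰ⊢ → An⊢[𝒩⊢⊞]` of the node's decl of record is an equivalence** (Prop 5.8 (vii) "natural
equivalence of categories `Th⊢[Z] ⥲ An⊢[𝒩⊢⊞_w]`", realised in `DEdge.functor` by the interface datum `κAnMono`).
[cite: MochizukiAbsTopIII2015, Prop 5.8 (vii) p. 141] -/
theorem dEdge_κAnMono_isEquivalence : (DEdge.functor S DEdge.κAnMono).IsEquivalence :=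
  S.κAnMono.isEquivalence_functor

/-- **The `D•⊢` arrow `An⊢[𝒩⊢⊞] → ℰ⊢` (row 6 → row 7) of the node's decl of record is an equivalence** (the
inverse of the equivalence of Prop 5.8 (vii), as realised in `DEdge.functor`).
[cite: MochizukiAbsTopIII2015, Prop 5.8 (vii) p. 141] -/
theorem dEdge_anMonoToE_isEquivalence : (DEdge.functor S DEdge.anMonoToE).IsEquivalence :=
  S.κAnMono.isEquivalence_inverse

end LogFrobeniusSetting

end Literature.AnabelianGeometry.AbsoluteAnabelian

end
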